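import Mathlib
import Summits.ResolutionOfSingularities.ResolutionOfSingularities.Theorems.RadicialJungCleanModelsLens5AbsDerivationF0
import Literature.AlgebraicGeometry.Resolution.TranscendenceDefect
import Literature.AlgebraicGeometry.Resolution.LocalBlowup
import HarnessLib

/-!
# Route `RadicialJung`, crux `CleanModels` (stmt-15917): LEMMA D-abs — an ABSOLUTE derivation moving any non-`p`-th power and preserving
# a finitely generated algebra up to a denominator (PORT of res-B-lens-5 g7's `Lens5_AbsDerivation.lean`, part 2), and the registered
# stub `stub_cleanLU3DefectArcConstants` (Sketch rev 22) closed EX FALSO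

Line `Sketch` rev 22 of crux stmt-ResolutionOfSingularities-15917; lead `res-B-lead-1` g3 lands the kernel-checked crux workfile of seat
res-B-lens-5 g7 (AUTHOR of the mathematics and of the Lean text of `absDerivation_of_forall_pow_ne`; the lead re-homes it and adds the
stub closer).  OURS; nothing here proves resolution in characteristic `p`.

* `absDerivation_of_forall_pow_ne'` — for `A` finitely generated over a field `k` of characteristic `p` with `Frac A = K` and `g₀ ∉ K^p`
  there is a derivation `D` of `K` (over `ℤ`, in general NOT `k`-linear) with `D g₀ ≠ 0` and `s • D(A) ⊆ A` for some `s ≠ 0`: take a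
  `p`-basis `Γ ∋ g₀` of `K/K^p`, `D = ∂_{g₀}`; LEMMA F₀ (`…Lens5AbsDerivationF0`) bounds the denominators of `D` on `A`.
* `stub_cleanLU3DefectArcConstants` (rev 22, statement VERBATIM from `Cruxes/CleanModels/Lines/Sketch.lean`): its hypothesis «NO
  derivation of `K` moving `g₀` preserves `A` up to a denominator» contradicts LEMMA D-abs — the corner is EMPTY over every ground field.
-/

noncomputable section

set_option linter.dupNamespace false -- mandated namespace of this single-conjunct summit

open Polynomial
open IsLocalRing
open Literature.AlgebraicGeometry.Resolution
open Literature.RingTheory.PBasis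
open Summit.ResolutionOfSingularities.ResolutionOfSingularities.Theorems.RadicialJung.CleanModels

namespace Summit.ResolutionOfSingularities.ResolutionOfSingularities.Theorems.RadicialJung.CleanModels.Lens5.AbsDerivation

variable {K : Type} [Field K]


/-- **LEMMA D-abs from LEMMA F₀.**  For a finitely generated `k`-algebra `A` with fraction field `K` (characteristic `p`) and `g₀ ∈ K`
not a `p`-th power, there is a derivation `D` of `K` (over `ℤ`; in general NOT `k`-linear) with `D g₀ ≠ 0` and `s • D(A) ⊆ A` for some
`s ≠ 0`. [folklore] -/
theorem absDerivation_of_forall_pow_ne (p : ℕ) (hp : p.Prime) (hF : ∀ (K : Type) [Field K] [CharP K p] (F M : Subfield K) (w : Finset K),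
      F ≤ M → (∀ x ∈ M, x ^ p ∈ F) → (M : Set K) ⊆ (Subfield.closure ((F : Set K) ∪ ↑w) : Set K) →
      ∃ (f : ℕ) (μ : Fin f → K), ∀ x ∈ M, ∃ a : Fin f → K, (∀ j, a j ∈ F) ∧ x = ∑ j, a j * μ j)
    (k : Type) [Field k] [CharP k p] (K : Type) [Field K] [Algebra k K] (A : Subalgebra k K)
    (hAfg : A.FG) (hfrac : IsFractionRing A K) (g₀ : K) (hg : ∀ c : K, c ^ p ≠ g₀) :
    ∃ (D : Derivation ℤ K K) (s : K), s ≠ 0 ∧ (∀ y : K, y ∈ A → s * D y ∈ A) ∧ D g₀ ≠ 0 := by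
  classical
  haveI : Fact p.Prime := ⟨hp⟩
  haveI : CharP K p := charP_of_injective_algebraMap (algebraMap k K).injective p
  obtain ⟨t, rfl⟩ := hAfg
  haveI := hfrac
  -- Step 1: `{g₀}` is `p`-independent
  have hg₀cl : g₀ ∉ Subring.closure (Set.range (frobenius K p) ∪ (∅ : Set K)) := by
    rw [Set.union_empty, ← RingHom.coe_range, Subring.closure_eq]
    intro h
    obtain ⟨c, hc⟩ := RingHom.mem_range.mp h
    exact hg c (by rw [← frobenius_def]; exact hc)
  have hB₀ind := pIndep_insert p ∅ (pIndep_empty p) hg₀cl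
  -- Step 2: `B₁ ⊇ {g₀}` maximal `p`-independent inside `{g₀} ∪ k'`
  obtain ⟨B₁, hB₀B₁, hB₁Y, hB₁ind, hYB₁⟩ :=
    exists_maximal_pIndep p (insert g₀ (Set.range (algebraMap k K))) (insert g₀ ∅)
      (Set.insert_subset_insert (Set.empty_subset _)) hB₀ind
  have hg₀B₁ : g₀ ∈ B₁ := hB₀B₁ (Set.mem_insert _ _)
  -- Step 3: a `p`-basis `Γ ⊇ B₁` and the dual derivation at `g₀`
  obtain ⟨Γ, hB₁Γ, -, hΓind, hΓgen⟩ := exists_maximal_pIndep p Set.univ B₁ (Set.subset_univ _) hB₁ind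
  have hΓ : IsPBasisOver p (frobenius K p).range Γ := isPBasisOver_of_pIndep_of_univ_subset p hΓind hΓgen
  have hg₀Γ : g₀ ∈ Γ := hB₁Γ hg₀B₁
  obtain ⟨D, hDg₀, hDΓ⟩ := IsPBasisOver.exists_dual_derivation hΓ ⟨g₀, hg₀Γ⟩
  -- Step 4: `D` kills `B₁' = B₁ ∖ {g₀}` and `L₀ = K^p[B₁']`
  set B₁' : Set K := B₁ \ {g₀} with hB₁'
  have hDB₁' : ∀ b ∈ B₁', D b = 0 := by
    rintro b ⟨hb, hbg⟩
    exact hDΓ ⟨b, hB₁Γ hb⟩ fun h => hbg (congrArg Subtype.val h)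
  have hDL₀ : ∀ x ∈ Subring.closure (Set.range (frobenius K p) ∪ B₁'), D x = 0 := fun x hx =>
    derivation_eq_zero_of_mem_closure p D hDB₁' hx
  have hB₁'k' : B₁' ⊆ Set.range (algebraMap k K) := by
    rintro b ⟨hb, hbg⟩
    rcases hB₁Y hb with h | h
    · exact absurd h hbg
    · exact h
  -- the subfields `L₀ = K^p(B₁')`, `k' = im k`, `k₂ = k' ∩ L₀`
  let L₀ : Subfield K := Subfield.closure (Set.range (frobenius K p) ∪ B₁')
  have hL₀mem : ∀ z, z ∈ L₀ ↔ z ∈ Subring.closure (Set.range (frobenius K p) ∪ B₁') :=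
    fun z => mem_subfieldClosure_iff p _ Set.subset_union_left z
  let kf : Subfield K := (algebraMap k K).fieldRange
  let k₂ : Subfield K := kf ⊓ L₀
  have hk₂A : ∀ z ∈ k₂, z ∈ Algebra.adjoin k (↑t : Set K) := by
    intro z hz
    obtain ⟨c, rfl⟩ := RingHom.mem_fieldRange.mp (Subfield.mem_inf.mp hz).1
    exact Subalgebra.algebraMap_mem _ c
  have hk₂D : ∀ z ∈ k₂, D z = 0 := fun z hz =>
    hDL₀ z ((hL₀mem z).mp (Subfield.mem_inf.mp hz).2)
  -- Step 5: the finiteness input, applied to `k₂ ≤ k' ≤ k₂(x^p, g₀)`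
  let w : Finset K := insert g₀ (t.image fun x => x ^ p)
  have hFM : k₂ ≤ kf := inf_le_left
  have hpow : ∀ x ∈ kf, x ^ p ∈ k₂ := fun x hx =>
    Subfield.mem_inf.mpr ⟨pow_mem hx p, (hL₀mem _).mpr (Subring.subset_closure (Or.inl ⟨x, frobenius_def ..⟩))⟩
  have hMN : (kf : Set K) ⊆ (Subfield.closure ((k₂ : Set K) ∪ ↑w) : Set K) := by
    -- (a) `p`-th powers of elements of `A`, hence of `K = Frac A`, lie in `N = k₂(w)`
    have hA_N : ∀ z ∈ Algebra.adjoin k (↑t : Set K), z ^ p ∈ Subfield.closure ((k₂ : Set K) ∪ ↑w) := by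
      intro z hz
      rw [Algebra.mem_adjoin_iff] at hz
      have hle : Subring.closure (Set.range (algebraMap k K) ∪ ↑t) ≤
          ((Subfield.closure ((k₂ : Set K) ∪ ↑w)).comap (frobenius K p)).toSubring := by
        rw [Subring.closure_le]
        rintro x (⟨c, rfl⟩ | hx)
        · show frobenius K p (algebraMap k K c) ∈ Subfield.closure ((k₂ : Set K) ∪ ↑w)
          rw [frobenius_def]
          exact Subfield.subset_closure (Or.inl (hpow _ (RingHom.mem_fieldRange.mpr ⟨c, rfl⟩)))
        · show frobenius K p x ∈ Subfield.closure ((k₂ : Set K) ∪ ↑w)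
          rw [frobenius_def]
          exact Subfield.subset_closure (Or.inr (Finset.mem_coe.mpr
            (Finset.mem_insert_of_mem (Finset.mem_image_of_mem _ (Finset.mem_coe.mp hx)))))
      have := hle hz
      rw [Subfield.mem_toSubring, Subfield.mem_comap, frobenius_def] at this
      exact this
    have hK_N : ∀ c : K, c ^ p ∈ Subfield.closure ((k₂ : Set K) ∪ ↑w) := by
      intro c
      obtain ⟨x, y, -, hxy⟩ := IsFractionRing.div_surjective (A := Algebra.adjoin k (↑t : Set K)) c
      rw [← hxy]
      change ((x : K) / (y : K)) ^ p ∈ _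
      rw [div_pow]
      exact div_mem (hA_N x x.2) (hA_N y y.2)
    -- (b) `k' ⊆ K^p[B₁] ⊆ N`
    intro z hz
    obtain ⟨c, rfl⟩ := RingHom.mem_fieldRange.mp hz
    have h1 : algebraMap k K c ∈ Subring.closure (Set.range (frobenius K p) ∪ B₁) :=
      hYB₁ (Set.mem_insert_of_mem _ ⟨c, rfl⟩)
    have hle : Subring.closure (Set.range (frobenius K p) ∪ B₁) ≤
        (Subfield.closure ((k₂ : Set K) ∪ ↑w)).toSubring := by
      rw [Subring.closure_le]
      rintro x (⟨y, rfl⟩ | hx)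
      · show frobenius K p y ∈ Subfield.closure ((k₂ : Set K) ∪ ↑w)
        rw [frobenius_def]
        exact hK_N y
      · show x ∈ Subfield.closure ((k₂ : Set K) ∪ ↑w)
        by_cases hxg : x = g₀
        · rw [hxg]
          exact Subfield.subset_closure (Or.inr (Finset.mem_coe.mpr (Finset.mem_insert_self g₀ _)))
        · have hx' : x ∈ B₁' := ⟨hx, hxg⟩
          exact Subfield.subset_closure (Or.inl (Subfield.mem_inf.mpr
            ⟨RingHom.mem_fieldRange.mpr (hB₁'k' hx'), (hL₀mem _).mpr (Subring.subset_closure (Or.inr hx'))⟩))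
    exact hle h1
  obtain ⟨f, μ, hμ⟩ := hF K k₂ kf w hFM hpow hMN
  -- Step 6: denominators
  have hfr := fun x : K => IsFractionRing.div_surjective (A := Algebra.adjoin k (↑t : Set K)) (D x)
  choose a b hb hab using hfr
  have hb0 : ∀ x, ((b x : Algebra.adjoin k (↑t : Set K)) : K) ≠ 0 := fun x h =>
    nonZeroDivisors.ne_zero (hb x) (Subtype.ext h)
  have hDx : ∀ x, D x = ((a x : Algebra.adjoin k (↑t : Set K)) : K) / ((b x : Algebra.adjoin k (↑t : Set K)) : K) :=
    fun x => (hab x).symm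
  set s : K := (∏ x ∈ t, ((b x : Algebra.adjoin k (↑t : Set K)) : K)) *
    ∏ j : Fin f, ((b (μ j) : Algebra.adjoin k (↑t : Set K)) : K) with hs
  have hs0 : s ≠ 0 := mul_ne_zero (Finset.prod_ne_zero_iff.mpr fun x _ => hb0 x)
    (Finset.prod_ne_zero_iff.mpr fun j _ => hb0 (μ j))
  -- `s * D z ∈ A` as soon as `s = r * den(D z)` with `r ∈ A`
  have hkey : ∀ (z r : K), r ∈ Algebra.adjoin k (↑t : Set K) →
      s = r * ((b z : Algebra.adjoin k (↑t : Set K)) : K) → s * D z ∈ Algebra.adjoin k (↑t : Set K) := by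
    intro z r hr hsr
    rw [hsr, hDx z, mul_assoc, mul_div_assoc', mul_div_cancel_left₀ _ (hb0 z)]
    exact Subalgebra.mul_mem _ hr (a z).2
  have hst : ∀ x ∈ t, s * D x ∈ Algebra.adjoin k (↑t : Set K) := by
    intro x hx
    refine hkey x ((∏ z ∈ t.erase x, ((b z : Algebra.adjoin k (↑t : Set K)) : K)) *
      ∏ j : Fin f, ((b (μ j) : Algebra.adjoin k (↑t : Set K)) : K)) ?_ ?_
    · exact Subalgebra.mul_mem _ (Subalgebra.prod_mem _ fun z _ => (b z).2)
        (Subalgebra.prod_mem _ fun j _ => (b (μ j)).2)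
    · rw [hs, ← Finset.mul_prod_erase t (fun x => ((b x : Algebra.adjoin k (↑t : Set K)) : K)) hx]
      ring
  have hsμ : ∀ j, s * D (μ j) ∈ Algebra.adjoin k (↑t : Set K) := by
    intro j
    refine hkey (μ j) ((∏ x ∈ t, ((b x : Algebra.adjoin k (↑t : Set K)) : K)) *
      ∏ j' ∈ Finset.univ.erase j, ((b (μ j') : Algebra.adjoin k (↑t : Set K)) : K)) ?_ ?_
    · exact Subalgebra.mul_mem _ (Subalgebra.prod_mem _ fun z _ => (b z).2)
        (Subalgebra.prod_mem _ fun j' _ => (b (μ j')).2)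
    · rw [hs, ← Finset.mul_prod_erase Finset.univ
        (fun j' => ((b (μ j') : Algebra.adjoin k (↑t : Set K)) : K)) (Finset.mem_univ j)]
      ring
  -- `D` on the constants: `D(Σ a_j μ_j) = Σ a_j D μ_j`
  have hsk : ∀ c : k, s * D (algebraMap k K c) ∈ Algebra.adjoin k (↑t : Set K) := by
    intro c
    obtain ⟨a', ha', hc⟩ := hμ (algebraMap k K c) (RingHom.mem_fieldRange.mpr ⟨c, rfl⟩)
    rw [hc, map_sum, Finset.mul_sum]
    refine Subalgebra.sum_mem _ fun j _ => ?_
    rw [D.leibniz, hk₂D _ (ha' j), smul_zero, add_zero, smul_eq_mul, mul_left_comm]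
    exact Subalgebra.mul_mem _ (hk₂A _ (ha' j)) (hsμ j)
  refine ⟨D, s, hs0, fun y hy => ?_, ?_⟩
  · induction hy using Algebra.adjoin_induction with
    | mem x hx => exact hst x (Finset.mem_coe.mp hx)
    | algebraMap c => exact hsk c
    | add x y _ _ hx' hy' =>
      rw [map_add, mul_add]
      exact Subalgebra.add_mem _ hx' hy'
    | mul x y hx hy hx' hy' =>
      have h1 : s * D (x * y) = x * (s * D y) + y * (s * D x) := by
        rw [D.leibniz, smul_eq_mul, smul_eq_mul]
        ring
      rw [h1]
      exact Subalgebra.add_mem _ (Subalgebra.mul_mem _ hx hy') (Subalgebra.mul_mem _ hy hx')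
  · rw [hDg₀]
    exact one_ne_zero


/-- **LEMMA D-abs, UNCONDITIONAL** (LEMMA F₀ supplied by `LemmaF0.heightOneIntermediateFinite`). [folklore] -/
theorem absDerivation_of_forall_pow_ne' (p : ℕ) (hp : p.Prime)
    (k : Type) [Field k] [CharP k p] (K : Type) [Field K] [Algebra k K] (A : Subalgebra k K)
    (hAfg : A.FG) (hfrac : IsFractionRing A K) (g₀ : K) (hg : ∀ c : K, c ^ p ≠ g₀) :
    ∃ (D : Derivation ℤ K K) (s : K), s ≠ 0 ∧ (∀ y : K, y ∈ A → s * D y ∈ A) ∧ D g₀ ≠ 0 :=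
  absDerivation_of_forall_pow_ne p hp (LemmaF0.heightOneIntermediateFinite p hp) k K A hAfg hfrac g₀ hg

end Summit.ResolutionOfSingularities.ResolutionOfSingularities.Theorems.RadicialJung.CleanModels.Lens5.AbsDerivation

namespace Summit.ResolutionOfSingularities.ResolutionOfSingularities.Theorems.RadicialJung.CleanModels

/-- **Registered stub `stub_cleanLU3DefectArcConstants` of `Cruxes/CleanModels/Lines/Sketch.lean` rev 22 (statement VERBATIM), PROVED EX
FALSO**: its hypothesis «no derivation of `K` moving `g₀` and preserving `A` up to a denominator» contradicts LEMMA D-abs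
(`Lens5.AbsDerivation.absDerivation_of_forall_pow_ne'`, res-B-lens-5 g7). [folklore] -/
theorem stub_cleanLU3DefectArcConstants :
    ∀ (p : ℕ), p.Prime →
    ∀ (k : Type) [Field k] [CharP k p] (K : Type) [Field K] [Algebra k K]
    (O : ValuationSubring K) (A : Subalgebra k K), A.toSubring ≤ O.toSubring → A.FG → IsFractionRing A K →
    ringKrullDim A ≤ 3 → IsRegularLocalRing (locAtCentre A.toSubring O) →
    ringKrullDim (locAtCentre A.toSubring O) = 3 →
    (∀ (T : Subring K) (hT : T ≤ O.toSubring), A.toSubring ≤ T → (subringCentre T O hT).IsMaximal) →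
    ∀ g₀ : K, (∀ c : K, c ^ p ≠ g₀) →
    (∀ f₀ : K, ∃ f₁ : K, O.valuation (g₀ - f₁ ^ p) < O.valuation (g₀ - f₀ ^ p)) →
    (∀ hk : ∀ c : k, algebraMap k K c ∈ O, transcendenceDefect k O hk ≠ 0) →
    (∃ π : K, π ≠ 0 ∧ (∀ x : K, O.valuation x < 1 → O.valuation x ≤ O.valuation π) ∧
      (∀ x : K, x ≠ 0 → ∃ n : ℕ, O.valuation π ^ n ≤ O.valuation x)) →
    ¬ PerfectField k →
    ¬ (∃ (D : Derivation ℤ K K) (s : K), s ≠ 0 ∧ (∀ y : K, y ∈ A → s * D y ∈ A) ∧ D g₀ ≠ 0) →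
    g₀ ∈ Algebra.adjoin k (Set.range fun y : K => y ^ p) →
    ∃ (A' : Subalgebra k K), A'.toSubring ≤ O.toSubring ∧ A ≤ A' ∧ A'.FG ∧
    ∃ (_ : IsRegularLocalRing (locAtCentre A'.toSubring O)) (c : Fin p → K), (∃ j : Fin p, (j : ℕ) ≠ 0 ∧ c j ≠ 0) ∧
    ((∃ (d m : ℕ) (hmd : m ≤ d) (t : Fin d → ↥(locAtCentre A'.toSubring O)) (a : Fin m → ℕ) (u : ↥(locAtCentre A'.toSubring O)), IsUnit u ∧
    Ideal.span (Set.range t) = IsLocalRing.maximalIdeal ↥(locAtCentre A'.toSubring O) ∧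
    ringKrullDim ↥(locAtCentre A'.toSubring O) = (d : WithBot ℕ∞) ∧ 0 < m ∧ (∀ i, ¬ p ∣ a i) ∧
    (∑ j : Fin p, c j ^ p * g₀ ^ (j : ℕ)) = (u : K) * ∏ i : Fin m, ((t (Fin.castLE hmd i) : ↥(locAtCentre A'.toSubring O)) : K) ^ (a i)) ∨
    (∃ u : ↥(locAtCentre A'.toSubring O), IsUnit u ∧ (∑ j : Fin p, c j ^ p * g₀ ^ (j : ℕ)) = (u : K) ∧
    ∀ c' : ↥(locAtCentre A'.toSubring O), u - c' ^ p ∉ IsLocalRing.maximalIdeal ↥(locAtCentre A'.toSubring O)) ∨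
    (∃ s c' : ↥(locAtCentre A'.toSubring O), (∑ j : Fin p, c j ^ p * g₀ ^ (j : ℕ)) = (s : K) ∧
    s - c' ^ p ∈ IsLocalRing.maximalIdeal ↥(locAtCentre A'.toSubring O) ∧
    s - c' ^ p ∉ IsLocalRing.maximalIdeal ↥(locAtCentre A'.toSubring O) ^ 2)) := by
  intro p hp k _ _ K _ _ O A _ hAfg hfrac _ _ _ _ g₀ hg₀ _ _ _ _ hnD _
  exact absurd (Lens5.AbsDerivation.absDerivation_of_forall_pow_ne' p hp k K A hAfg hfrac g₀ hg₀) hnD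

end Summit.ResolutionOfSingularities.ResolutionOfSingularities.Theorems.RadicialJung.CleanModels

end
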